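import Literature.MathematicalPhysics.QuantumFieldTheory.Balaban1983to89.B7LocalityGeneral
import Literature.MathematicalPhysics.QuantumFieldTheory.Balaban1983to89.B7Eq123General
import Literature.MathematicalPhysics.QuantumFieldTheory.Balaban1983to89.T4AveragingDeficitWallBoundary
import Summits.QuantumFields.BalabanUV.T4Continuum.Support.ShellMeasureAverageLocality148
import HarnessLib

/-!
# NE7StrippedStepRemainderLocal — THE LOCAL ℓ¹ LETTER OF THE ONE-STEP STRIPPED REMAINDER: the second-order remainder `C(V₀, A, c) = Q(V₀,A,c) − L(Q(V₀)A)_c` of the double-bar average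
# ([Balaban1985Averaging] (122)) depends on `A` only in the block column of `c` and obeys `‖C(V₀,A,c)‖ ≤ (8∕c₃²)·Σ_{b ⊂ B(c₋)∪B(c₊)} ‖A_b‖²`; summed over the coarse period box:
# `Σ_{z,κ} ‖C(V₀, A, ⟨Lz, Lz+Le_κ⟩)‖ ≤ (8∕c₃²)·2d·Σ_{x ∈ periodBox(L·N′)} Σ_μ ‖A(x,μ)‖²` (lineage `b2b-balaban-t4-ne7-p1`, gen 119, file H12 = ROAD-G119 §5 S4′ (ii), the LOCAL estimate)

Cell `pub-balaban`, rung (B)+1 sub-cell t4, CRUX PROVER NE7 #1 (OWNER of row NE7), generation 119.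
WHY (memo ROAD-G119 §2(e)(f), §5 S4′).  The stripped-tower route to (G′) needs the multiplier letter `|Dm(0)[D²Ψ(0)[X,X]]| ≤ wεC·L²·η²·dirSq X̃`; by H2's level sum and row NE7b's ℓ¹ push-up and
multiplier density it reduces to ONE local estimate per level: the ℓ¹ mass of the one-step second-order term of the double-bar average is bounded by the ℓ² mass of the level field.  The function-level
form of that term is the printed remainder (122) `C(V₀, A, c)`, with the PRINTED bound (123) in the tree for the GLOBAL sup norm (✓ `B7Eq123General.norm_Ccov_le`: `‖C‖ ≤ (8∕c₃²)·(sup|A|)²`) and the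
LOCALITY of (121) in the tree (✓ `B7LocalityGeneral.Qcov_congr`: `Q(V₀,A,c)` depends on `A` only on bonds of `B(c₋) ∪ B(c₊)`).  THIS FILE combines them: localise `A` to the block column, where its
sup is at most its local ℓ² mass, and tile the coarse period box by block columns (multiplicity `2d`).
WHAT ([folklore]; 1 def (`colLoc`, the localisation), 0 sorry; general `d`, any complete normed algebra `𝔸`): `exists_boxVec_of_bounds`, `exists_boxVec_of_inBox_column` (a site of the column `[Lz, Lz + (L−1)𝟙 + Le_κ]` lies in the block of `z` or of
`z + e_κ`); `linQcov_congr` (locality of the linear part (122), from ✓ `Qcov_congr` through the ray derivative); `Ccov_congr`; **`norm_Ccov_le_local`**: `‖C(V₀, A, ⟨Lz, ·⟩_κ)‖ ≤ (8∕c₃²)·(Σ_{r,μ}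
‖A(Lz + r, μ)‖² + Σ_{r,μ} ‖A(L(z+e_κ) + r, μ)‖²)` under block-loop regularity `≤ 1∕64` at the bond and the smallness `2dL^d·(sup|A|)² ≤ c₃²`; **`sum_norm_Ccov_le_local`**: the displayed period-box
sum for `(L·N′)`-periodic `A`.
HONEST FRAMING (page 1): an elementary combination of two landed printed-type lemmas; nothing of Bałaban's asserted ((121)–(123) context; the tree's `norm_Ccov_le` is a proved theorem about OUR
objects); NOT (G′), NOT NE7 as a spine node; spine 0∕9; finite T⁴ rung (B)+1 — NOT infinite volume, NOT mass gap, NOT BetaPertH, NOT Clay.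
-/

set_option autoImplicit false

open scoped BigOperators
open Finset

namespace Summit.QuantumFields.BalabanUV.T4Continuum.NE7StrippedStepRemainderLocal

open Literature.MathematicalPhysics.QuantumFieldTheory.Balaban1983to89
open B7Prop1Explicit B7Prop2Explicit B7Prop3Flat
open B7Prop1Local (InBox AgreeOn bondHi)
open B7Prop3GeneralLinear (Qcov linQcov Ccov)
open B7LocalityGeneral (Qcov_congr)
open B7Eq123General (norm_Ccov_le)
open T4AveragingDeficitWallBoundary (periodBox sum_blocks_eq blockSites_periodBox sum_periodBox_shift)
open ShellMeasureAverageLocality148 (agreeOn_rfl agreeOn_smul)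

noncomputable section

variable {d : ℕ}

/-! ## §1 Geometry of the block column -/

/-- A site `x` with `L·w ≤ x < L·w + L` coordinatewise is `L•w + r` for a block offset `r`. [folklore] -/
theorem exists_boxVec_of_bounds {L : ℕ} (w x : Site d) (hlo : ∀ i, (L : ℤ) * w i ≤ x i) (hhi : ∀ i, x i < (L : ℤ) * w i + L) :
    ∃ r : Fin d → Fin L, x = (L : ℤ) • w + boxVec L r := by
  refine ⟨fun i => ⟨(x i - (L : ℤ) * w i).toNat, by
      have h1 := hlo i; have h2 := hhi i; zify; rw [Int.toNat_of_nonneg (by linarith)]; linarith⟩, ?_⟩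
  funext i
  simp only [Pi.add_apply, Pi.smul_apply, smul_eq_mul, boxVec]
  rw [Int.toNat_of_nonneg (by linarith [hlo i])]; ring

/-- **A site of the block column `[L•z, L•z + (L−1)𝟙 + L e_κ]` lies in the block of `z` or in the block of `z + e_κ`.** [folklore] -/
theorem exists_boxVec_of_inBox_column {L : ℕ} (z : Site d) (κ : Fin d) {x : Site d}
    (hx : InBox ((L : ℤ) • z) (bondHi L ((L : ℤ) • z) κ) x) :
    ∃ r : Fin d → Fin L, x = (L : ℤ) • z + boxVec L r ∨ x = (L : ℤ) • (z + e κ) + boxVec L r := by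
  have hlo : ∀ i, (L : ℤ) * z i ≤ x i := fun i => by
    have h := (hx i).1; simpa [Pi.smul_apply, smul_eq_mul] using h
  have hhi : ∀ i, x i ≤ (L : ℤ) * z i + ((L : ℤ) - 1) + (if i = κ then (L : ℤ) else 0) := fun i => by
    have h := (hx i).2; simpa [bondHi, Pi.smul_apply, smul_eq_mul] using h
  have heκ : ∀ i, (e κ : Site d) i = if i = κ then 1 else 0 := fun i => by
    simp only [e, Pi.single_apply]
  by_cases hκ : x κ < (L : ℤ) * z κ + L
  · -- in the block of `z`
    have hhi' : ∀ i, x i < (L : ℤ) * z i + L := by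
      intro i
      by_cases hi : i = κ
      · subst hi; exact hκ
      · have h := hhi i; rw [if_neg hi] at h; linarith
    obtain ⟨r, hr⟩ := exists_boxVec_of_bounds z x hlo hhi'
    exact ⟨r, Or.inl hr⟩
  · -- in the block of `z + e_κ`
    push Not at hκ
    have hlo' : ∀ i, (L : ℤ) * (z + e κ) i ≤ x i := by
      intro i
      rw [Pi.add_apply, heκ]
      by_cases hi : i = κ
      · subst hi; rw [if_pos rfl]; linarith
      · rw [if_neg hi, add_zero]; exact hlo i
    have hhi' : ∀ i, x i < (L : ℤ) * (z + e κ) i + L := by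
      intro i
      rw [Pi.add_apply, heκ]
      have h := hhi i
      by_cases hi : i = κ
      · subst hi; rw [if_pos rfl] at h ⊢; linarith
      · rw [if_neg hi] at h; rw [if_neg hi, add_zero]; linarith
    obtain ⟨r, hr⟩ := exists_boxVec_of_bounds (z + e κ) x hlo' hhi'
    exact ⟨r, Or.inr hr⟩

/-! ## §2 Locality of the linear part and of the remainder -/

section Local

variable {𝔸 : Type*} [NormedRing 𝔸] [NormedAlgebra ℂ 𝔸] [CompleteSpace 𝔸] [NormOneClass 𝔸]

omit [NormOneClass 𝔸] in
/-- **LOCALITY OF THE LINEAR PART (122)**: `L(Q(V₀)A)_c` depends on `A` only in the block column of `c` (the ray derivative of the local (121)). [cite: Balaban1985Averaging, (122) p.36, p.34] -/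
theorem linQcov_congr (L : ℕ) (hL : 1 ≤ L) (V₀ : Site d → Fin d → 𝔸ˣ) (q : Site d) (κ : Fin d) {A A' : Site d → Fin d → 𝔸}
    (hA : AgreeOn q (bondHi L q κ) A A') : linQcov L V₀ A q κ = linQcov L V₀ A' q κ := by
  unfold linQcov
  congr 1
  funext t
  exact Qcov_congr L hL q κ agreeOn_rfl (agreeOn_smul hA t)

omit [NormOneClass 𝔸] in
/-- **LOCALITY OF THE REMAINDER (122)**: `C(V₀, A, c)` depends on `A` only in the block column of `c`. [cite: Balaban1985Averaging, (122) p.36, p.34] -/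
theorem Ccov_congr (L : ℕ) (hL : 1 ≤ L) (V₀ : Site d → Fin d → 𝔸ˣ) (q : Site d) (κ : Fin d) {A A' : Site d → Fin d → 𝔸}
    (hA : AgreeOn q (bondHi L q κ) A A') : Ccov L V₀ A q κ = Ccov L V₀ A' q κ := by
  unfold Ccov
  rw [Qcov_congr L hL q κ agreeOn_rfl hA, linQcov_congr L hL V₀ q κ hA]

/-! ## §3 The local letter -/

omit [NormedAlgebra ℂ 𝔸] [CompleteSpace 𝔸] [NormOneClass 𝔸] in
/-- The block-column ℓ² mass of `A` at the coarse bond `(z, κ)` is non-negative. [folklore] -/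
theorem colMass_nonneg (L : ℕ) (A : Site d → Fin d → 𝔸) (z : Site d) (κ : Fin d) :
    0 ≤ (∑ r : Fin d → Fin L, ∑ μ : Fin d, ‖A ((L : ℤ) • z + boxVec L r) μ‖ ^ 2)
      + ∑ r : Fin d → Fin L, ∑ μ : Fin d, ‖A ((L : ℤ) • (z + e κ) + boxVec L r) μ‖ ^ 2 := by
  positivity

open Classical in
/-- THE LOCALISATION of a field to the block column of the coarse bond `(z, κ)` (zero off `B(L•z) ∪ B(L•(z+e_κ))`). [folklore] -/
def colLoc (L : ℕ) (A : Site d → Fin d → 𝔸) (z : Site d) (κ : Fin d) : Site d → Fin d → 𝔸 :=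
  fun x μ => if (∃ r : Fin d → Fin L, x = (L : ℤ) • z + boxVec L r ∨ x = (L : ℤ) • (z + e κ) + boxVec L r) then A x μ else 0

omit [NormedAlgebra ℂ 𝔸] [CompleteSpace 𝔸] [NormOneClass 𝔸] in
/-- The localisation agrees with the field on the block column. [folklore] -/
theorem agreeOn_colLoc (L : ℕ) (A : Site d → Fin d → 𝔸) (z : Site d) (κ : Fin d) :
    AgreeOn ((L : ℤ) • z) (bondHi L ((L : ℤ) • z) κ) A (colLoc L A z κ) := by
  intro x μ hx _
  unfold colLoc
  rw [if_pos (exists_boxVec_of_inBox_column z κ hx)]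

omit [NormedAlgebra ℂ 𝔸] [CompleteSpace 𝔸] [NormOneClass 𝔸] in
/-- The localisation is bounded, bondwise, by the square root of the block-column ℓ² mass. [folklore] -/
theorem norm_colLoc_le (L : ℕ) (A : Site d → Fin d → 𝔸) (z : Site d) (κ : Fin d) (x : Site d) (μ : Fin d) :
    ‖colLoc L A z κ x μ‖ ≤ Real.sqrt ((∑ r : Fin d → Fin L, ∑ μ' : Fin d, ‖A ((L : ℤ) • z + boxVec L r) μ'‖ ^ 2)
      + ∑ r : Fin d → Fin L, ∑ μ' : Fin d, ‖A ((L : ℤ) • (z + e κ) + boxVec L r) μ'‖ ^ 2) := by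
  unfold colLoc
  by_cases hx : ∃ r : Fin d → Fin L, x = (L : ℤ) • z + boxVec L r ∨ x = (L : ℤ) • (z + e κ) + boxVec L r
  · rw [if_pos hx]
    refine Real.le_sqrt_of_sq_le ?_
    have h0 : ∀ w : Site d, 0 ≤ ∑ r' : Fin d → Fin L, ∑ μ' : Fin d, ‖A ((L : ℤ) • w + boxVec L r') μ'‖ ^ 2 := fun w => by positivity
    have hle : ∀ (w : Site d) (r : Fin d → Fin L), ‖A ((L : ℤ) • w + boxVec L r) μ‖ ^ 2 ≤ ∑ r' : Fin d → Fin L, ∑ μ' : Fin d, ‖A ((L : ℤ) • w + boxVec L r') μ'‖ ^ 2 := by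
      intro w r
      have h1 : ‖A ((L : ℤ) • w + boxVec L r) μ‖ ^ 2 ≤ ∑ μ' : Fin d, ‖A ((L : ℤ) • w + boxVec L r) μ'‖ ^ 2 :=
        Finset.single_le_sum (f := fun μ' => ‖A ((L : ℤ) • w + boxVec L r) μ'‖ ^ 2) (fun _ _ => sq_nonneg _) (Finset.mem_univ μ)
      exact h1.trans (Finset.single_le_sum (f := fun r' => ∑ μ' : Fin d, ‖A ((L : ℤ) • w + boxVec L r') μ'‖ ^ 2)
        (fun _ _ => Finset.sum_nonneg fun _ _ => sq_nonneg _) (Finset.mem_univ r))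
    obtain ⟨r, hr | hr⟩ := hx
    · rw [hr]; linarith [hle z r, h0 (z + e κ)]
    · rw [hr]; linarith [hle (z + e κ) r, h0 z]
  · rw [if_neg hx, norm_zero]; exact Real.sqrt_nonneg _

/-- **THE LOCAL LETTER OF THE ONE-STEP STRIPPED REMAINDER**: at a background `V₀` with values in the unit-ball group `U1` whose block loops at the `L`-bond `c = ⟨L•z, L•z + Le_κ⟩` are within `α ≤ 1∕64`
of `1`, for a field `A` with `sup‖A‖ ≤ b` and `2dL^d·b² ≤ c₃²` (so that every block-column ℓ² mass is `≤ c₃²`):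
`‖C(V₀, A, c)‖ ≤ (8∕c₃²)·(Σ_{r,μ} ‖A(L•z + r, μ)‖² + Σ_{r,μ} ‖A(L•(z+e_κ) + r, μ)‖²)`. [cite: Balaban1985Averaging, (122)–(123) p.36] -/
theorem norm_Ccov_le_local {L : ℕ} (hL : 1 ≤ L) {V₀ : Site d → Fin d → 𝔸ˣ} (hV₀ : ∀ x κ, V₀ x κ ∈ U1 𝔸)
    (A : Site d → Fin d → 𝔸) {b α : ℝ} (hA : ∀ x μ, ‖A x μ‖ ≤ b)
    (hbc : 2 * (d : ℝ) * (L : ℝ) ^ d * b ^ 2 ≤ (c3 d L) ^ 2) (z : Site d) (κ : Fin d) (hα1 : α ≤ 1 / 64)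
    (hreg : ∀ r : Fin d → Fin L, ‖((Wcx L V₀ ((L : ℤ) • z) κ (boxVec L r) : 𝔸ˣ) : 𝔸) - 1‖ ≤ α) :
    ‖Ccov L V₀ A ((L : ℤ) • z) κ‖
      ≤ 8 / (c3 d L) ^ 2 * ((∑ r : Fin d → Fin L, ∑ μ : Fin d, ‖A ((L : ℤ) • z + boxVec L r) μ‖ ^ 2)
          + ∑ r : Fin d → Fin L, ∑ μ : Fin d, ‖A ((L : ℤ) • (z + e κ) + boxVec L r) μ‖ ^ 2) := by
  have hS0 := colMass_nonneg L A z κ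
  -- the column mass is small: `≤ 2dL^d b² ≤ c₃²`
  have hblk : ∀ w : Site d, ∑ r : Fin d → Fin L, ∑ μ : Fin d, ‖A ((L : ℤ) • w + boxVec L r) μ‖ ^ 2 ≤ (L : ℝ) ^ d * ((d : ℝ) * b ^ 2) := by
    intro w
    have h1 : ∀ r : Fin d → Fin L, ∑ μ : Fin d, ‖A ((L : ℤ) • w + boxVec L r) μ‖ ^ 2 ≤ (d : ℝ) * b ^ 2 := by
      intro r
      calc ∑ μ : Fin d, ‖A ((L : ℤ) • w + boxVec L r) μ‖ ^ 2 ≤ ∑ _μ : Fin d, b ^ 2 :=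
            Finset.sum_le_sum fun μ _ => pow_le_pow_left₀ (norm_nonneg _) (hA _ μ) 2
        _ = (d : ℝ) * b ^ 2 := by rw [Finset.sum_const, Finset.card_univ, Fintype.card_fin, nsmul_eq_mul]
    calc ∑ r : Fin d → Fin L, ∑ μ : Fin d, ‖A ((L : ℤ) • w + boxVec L r) μ‖ ^ 2
        ≤ ∑ _r : Fin d → Fin L, (d : ℝ) * b ^ 2 := Finset.sum_le_sum fun r _ => h1 r
      _ = (L : ℝ) ^ d * ((d : ℝ) * b ^ 2) := by
          rw [Finset.sum_const, Finset.card_univ, Fintype.card_fun, Fintype.card_fin, Fintype.card_fin, nsmul_eq_mul]; push_cast; ring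
  have hSb : (∑ r : Fin d → Fin L, ∑ μ : Fin d, ‖A ((L : ℤ) • z + boxVec L r) μ‖ ^ 2)
      + ∑ r : Fin d → Fin L, ∑ μ : Fin d, ‖A ((L : ℤ) • (z + e κ) + boxVec L r) μ‖ ^ 2 ≤ (c3 d L) ^ 2 := by
    have := hblk z; have := hblk (z + e κ); nlinarith
  have hc3 : 0 < c3 d L := by unfold c3; positivity
  have hsqS : Real.sqrt ((∑ r : Fin d → Fin L, ∑ μ : Fin d, ‖A ((L : ℤ) • z + boxVec L r) μ‖ ^ 2)
      + ∑ r : Fin d → Fin L, ∑ μ : Fin d, ‖A ((L : ℤ) • (z + e κ) + boxVec L r) μ‖ ^ 2) ≤ c3 d L := by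
    rw [← Real.sqrt_sq hc3.le]
    exact Real.sqrt_le_sqrt hSb
  -- locality + the printed bound for the localised field
  rw [Ccov_congr L hL V₀ ((L : ℤ) • z) κ (agreeOn_colLoc L A z κ)]
  have h := norm_Ccov_le (d := d) hL hV₀ (colLoc L A z κ) (Real.sqrt_nonneg _) (norm_colLoc_le L A z κ) hsqS ((L : ℤ) • z) κ hα1 hreg
  rw [Real.sq_sqrt hS0] at h
  exact h

/-- **THE LOCAL LETTER SUMMED OVER THE COARSE PERIOD BOX**: for an `(L·N′)`-periodic `A` (same hypotheses at every coarse bond),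
`Σ_{z ∈ periodBox N′} Σ_κ ‖C(V₀, A, ⟨L•z, ·⟩_κ)‖ ≤ (8∕c₃²)·(2d)·Σ_{x ∈ periodBox (L·N′)} Σ_μ ‖A(x,μ)‖²`. [folklore] -/
theorem sum_norm_Ccov_le_local {L N' : ℕ} (hL : 1 ≤ L) (hN' : 1 ≤ N') {V₀ : Site d → Fin d → 𝔸ˣ} (hV₀ : ∀ x κ, V₀ x κ ∈ U1 𝔸)
    (A : Site d → Fin d → 𝔸) {b α : ℝ} (hA : ∀ x μ, ‖A x μ‖ ≤ b)
    (hbc : 2 * (d : ℝ) * (L : ℝ) ^ d * b ^ 2 ≤ (c3 d L) ^ 2) (hα1 : α ≤ 1 / 64)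
    (hreg : ∀ (q : Site d) (κ : Fin d) (r : Fin d → Fin L), ‖((Wcx L V₀ q κ (boxVec L r) : 𝔸ˣ) : 𝔸) - 1‖ ≤ α)
    (hAP : ∀ (x : Site d) (i : Fin d) (μ : Fin d), A (x + ((L * N' : ℕ) : ℤ) • e i) μ = A x μ) :
    ∑ z ∈ periodBox (d := d) N', ∑ κ : Fin d, ‖Ccov L V₀ A ((L : ℤ) • z) κ‖
      ≤ 8 / (c3 d L) ^ 2 * (2 * (d : ℝ)) * ∑ x ∈ periodBox (d := d) (L * N'), ∑ μ : Fin d, ‖A x μ‖ ^ 2 := by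
  have hc : 0 ≤ 8 / (c3 d L) ^ 2 := by positivity
  -- block masses and their periodicity
  have hgP : ∀ (x : Site d) (i : Fin d), (∑ μ : Fin d, ‖A (x + ((L * N' : ℕ) : ℤ) • e i) μ‖ ^ 2) = ∑ μ : Fin d, ‖A x μ‖ ^ 2 := by
    intro x i; simp only [hAP]
  have hBP : ∀ (w : Site d) (i : Fin d),
      (∑ r : Fin d → Fin L, ∑ μ : Fin d, ‖A ((L : ℤ) • (w + (N' : ℤ) • e i) + boxVec L r) μ‖ ^ 2)
        = ∑ r : Fin d → Fin L, ∑ μ : Fin d, ‖A ((L : ℤ) • w + boxVec L r) μ‖ ^ 2 := by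
    intro w i
    refine Finset.sum_congr rfl fun r _ => ?_
    have e1 : (L : ℤ) • (w + (N' : ℤ) • e i) + boxVec L r = ((L : ℤ) • w + boxVec L r) + ((L * N' : ℕ) : ℤ) • e i := by
      rw [smul_add, smul_smul]; push_cast; abel
    rw [e1, hgP]
  -- pointwise letter at every coarse bond
  have hpt : ∀ z ∈ periodBox (d := d) N', ∑ κ : Fin d, ‖Ccov L V₀ A ((L : ℤ) • z) κ‖
      ≤ ∑ κ : Fin d, 8 / (c3 d L) ^ 2 * ((∑ r : Fin d → Fin L, ∑ μ : Fin d, ‖A ((L : ℤ) • z + boxVec L r) μ‖ ^ 2)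
          + ∑ r : Fin d → Fin L, ∑ μ : Fin d, ‖A ((L : ℤ) • (z + e κ) + boxVec L r) μ‖ ^ 2) :=
    fun z _ => Finset.sum_le_sum fun κ _ => norm_Ccov_le_local hL hV₀ A hA hbc z κ hα1 (hreg _ κ)
  refine (Finset.sum_le_sum hpt).trans (le_of_eq ?_)
  -- tiling of the fine period box by blocks, and shift invariance of the block-mass sum
  have htile : ∑ z ∈ periodBox (d := d) N', ∑ r : Fin d → Fin L, ∑ μ : Fin d, ‖A ((L : ℤ) • z + boxVec L r) μ‖ ^ 2
      = ∑ x ∈ periodBox (d := d) (L * N'), ∑ μ : Fin d, ‖A x μ‖ ^ 2 := by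
    rw [sum_blocks_eq L hL (periodBox (d := d) N') (fun x => ∑ μ : Fin d, ‖A x μ‖ ^ 2), blockSites_periodBox L N' hL]
  have hshift : ∀ κ : Fin d, ∑ z ∈ periodBox (d := d) N', ∑ r : Fin d → Fin L, ∑ μ : Fin d, ‖A ((L : ℤ) • (z + e κ) + boxVec L r) μ‖ ^ 2
      = ∑ x ∈ periodBox (d := d) (L * N'), ∑ μ : Fin d, ‖A x μ‖ ^ 2 := by
    intro κ
    rw [← htile]
    exact sum_periodBox_shift N' hN' (g := fun w => ∑ r : Fin d → Fin L, ∑ μ : Fin d, ‖A ((L : ℤ) • w + boxVec L r) μ‖ ^ 2) hBP (e κ)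
  rw [Finset.sum_comm]
  simp_rw [← Finset.mul_sum, Finset.sum_add_distrib, htile, hshift]
  rw [Finset.sum_const, Finset.card_univ, Fintype.card_fin, nsmul_eq_mul]
  ring

end Local

end

end Summit.QuantumFields.BalabanUV.T4Continuum.NE7StrippedStepRemainderLocal
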